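import Literature.AnabelianGeometry.SemiGraphs.LocalizationsProperties
import Literature.AnabelianGeometry.AbsoluteAnabelian.ProfiniteTerminology
import Mathlib.CategoryTheory.EssentialImage

/-!
# Categories of localizations, III: associated anabelioids ([SemiAnbd] §4: Prop 4.4 (i)–(iv), Rmk 4.8.2 (final clause))

Mochizuki, *Semi-graphs of anabelioids*, Publ. RIMS **42** (2006), §4 pp.54–55, 60 of the author's
manuscript (kurims `paper:url-f33ace170ff4`). [cite: MochizukiSemiAnbd2006, Prop 4.4, p. 54]

These items speak about the ANABELIOID `B(H)` of a semi-graph of anabelioids `H` and its profinite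
fundamental group `Π_H := π̂₁(B(H))` (§2 pp.22–23), about pull-backs of finite étale coverings, and
about "relatively slim `π₁`-monomorphisms" ([GeoAn] = [Mzk4]); none of this is in the §§1–3
container `SemiAnbdVocab`, and all of it is owned by abc-iut-L3-t1 (§2 / [GeoAn] substrate).  They
are therefore typed over a SECOND, small stub-container `AnabelioidVocab` (TODO-merge
abc-iut-L3-t1; merge = one term from t1's files, in the same merge pass as `SemiAnbdVocab.ofReal`):
`fundGroup H` (a bundled profinite group for `Π_H`), `fundMap f` (a representative of the outer
homomorphism a locally open arrow induces), `pullbackComponents f p` (the connected components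
`H'` of the pull-back to `H` of a
finite étale covering `p : K' → K` along `f : H → K`, with their two projections).  `B(Π)` is the
tree's `Literature.AlgebraicGeometry.Frobenioids.BCat` ([SemiAnbd] §0 p.6 = [FrdI] §0 p.13) and
`B(K)⁰` its `ConnectedPart`; "slim anabelioid `B(H)`" = `IsSlimGroup (fundGroup H)` (§0 p.6);
"relatively slim" = the tree's `AbsoluteAnabelian.IsRelativelySlim` on `fundMap f` ([AbsAnab]
Def 0.1 (ii), the group-theoretic form of the [GeoAn] notion).

* Prop 4.4 (i)–(iv) as `Prop`-valued STATEMENTS (not asserted, not proved); (iv)'s full embedding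
  `B(K)⁰ ↪ Loc(𝔾, Γ)_K` (`Loc(𝔾, Γ)_K` = Mathlib `Over K`) with its essential image, and the case
  `K = 𝔾` ("the essential image … is the full subcategory of closed objects") for a closed object
  whose structure morphism is an isomorphism.  BINDING (as in `LocalizationsProperties.lean`):
  every statement is guarded by `LocHypotheses 𝓥 G Γ →` — the standing hypotheses of p.51 under
  which alone the print DEFINES `Loc(𝔾, Γ)` — so that none asserts a printed conclusion for a pair
  `(𝔾, Γ)` the print never forms.
* Rmk 4.8.2, final clause: under the equivalent conditions (i)–(v), `Loc(𝔾, Γ)^⊥ ≃ B(𝔾)`.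
Still NOT typed (need t2's temperoid `B^temp(𝔾)` / the Appendix): Prop 4.5's "in particular"
clause, Rmk 4.8.4's second clause.  Nothing in this file asserts a result of the paper.
-/

namespace Literature.AnabelianGeometry.SemiGraphs

open _root_.CategoryTheory Literature.AlgebraicGeometry.Frobenioids Literature.AnabelianGeometry

universe u v w

/-- STUB-CONTAINER (TODO-merge abc-iut-L3-t1, §2 pp.22–23 and the [GeoAn] substrate): the
anabelioid-level data Prop 4.4 speaks about — `Π_H := π̂₁(B(H))` as a bundled profinite group, the
(representative of the outer) homomorphism `Π_H → Π_K` induced by a locally open arrow `H → K`, and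
the connected components of the pull-back of a finite étale covering along an arrow.
[cite: MochizukiSemiAnbd2006, §2, p. 23] -/
structure AnabelioidVocab (Obj : Type u) [Category.{v} Obj] where
  /-- `Π_H := π̂₁(B(H))`, "the fundamental group of the connected anabelioid `B(H)`" (§2 p.23) -/
  fundGroup : Obj → ProfiniteGrp.{w}
  /-- the homomorphism `Π_H → Π_K` induced by `H → K` (a representative of the outer homomorphism) -/
  fundMap : {H K : Obj} → (H ⟶ K) → (fundGroup H →* fundGroup K)
  /-- it is continuous -/
  continuous_fundMap : ∀ {H K : Obj} (f : H ⟶ K), Continuous (fundMap f)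
  /-- the connected components `H'` of the pull-back to `H`, along `f : H → K`, of a finite étale
  covering `p : K' → K`, each with its projections `H' → H`, `H' → K'` (§2 p.23) -/
  pullbackComponents : {H K K' : Obj} → (H ⟶ K) → (K' ⟶ K) → Set (Σ H' : Obj, (H' ⟶ H) × (H' ⟶ K'))

variable {Obj : Type u} [Category.{v} Obj] (𝓥 : SemiAnbdVocab.{u, v, w} Obj)
  (𝓐 : AnabelioidVocab.{u, v, w} Obj)

namespace Loc

variable (G : Obj) (Γ : Subgroup (Aut G))

/-! ### Proposition 4.4 (Associated Anabelioids) — statements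
(each guarded by `LocHypotheses 𝓥 G Γ`, p.51: the hypotheses under which `Loc(𝔾, Γ)` is defined) -/

/-- **Prop 4.4 (i)**: for a morphism `H → K` between finite objects, "there exists a finite étale
covering `K' → K` of `K` such that the induced morphism `H' → K'` from any connected component `H'`
of the pull-back of this finite étale covering to `H` is an embedding".
[cite: MochizukiSemiAnbd2006, Prop 4.4 (i), p. 54] -/
def AssociatedAnabelioidsStatementI (G : Obj) (Γ : Subgroup (Aut G)) : Prop :=
  LocHypotheses 𝓥 G Γ →
    ∀ (X Y : LocObj 𝓥 G Γ) (f : X ⟶ Y), X.IsFiniteObj 𝓥 → Y.IsFiniteObj 𝓥 →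
      ∃ (K' : Obj) (p : K' ⟶ Y.U), 𝓥.IsFiniteEtale p ∧
        ∀ c ∈ 𝓐.pullbackComponents f.hom p, 𝓥.IsEmbedding c.2.2

/-- **Prop 4.4 (ii)**: for a finite object `K`, "there exists a finite étale covering `K' → K` of
`K` such that `K'` embeds into a finite étale covering `𝔾' → 𝔾` of `𝔾`".
[cite: MochizukiSemiAnbd2006, Prop 4.4 (ii), p. 54] -/
def AssociatedAnabelioidsStatementII (G : Obj) (Γ : Subgroup (Aut G)) : Prop :=
  LocHypotheses 𝓥 G Γ →
    ∀ Y : LocObj 𝓥 G Γ, Y.IsFiniteObj 𝓥 →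
      ∃ (K' : Obj) (p : K' ⟶ Y.U) (G' : Obj) (q : G' ⟶ G) (i : K' ⟶ G'),
        𝓥.IsFiniteEtale p ∧ 𝓥.IsFiniteEtale q ∧ 𝓥.IsEmbedding i

/-- **Prop 4.4 (iii)**: a morphism `H → K` between finite objects "induces a relatively slim
`π₁`-monomorphism of slim anabelioids `B(H) → B(K)` which completely determines the original
morphism `H → K` [among all morphisms in `Loc(𝔾, Γ)` from `H` to `K`]" (determination: as an outer
homomorphism, i.e. up to `Π_K`-conjugation). [cite: MochizukiSemiAnbd2006, Prop 4.4 (iii), p. 54] -/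
def AssociatedAnabelioidsStatementIII (G : Obj) (Γ : Subgroup (Aut G)) : Prop :=
  LocHypotheses 𝓥 G Γ →
    ∀ (X Y : LocObj 𝓥 G Γ) (f : X ⟶ Y), X.IsFiniteObj 𝓥 → Y.IsFiniteObj 𝓥 →
      IsSlimGroup (𝓐.fundGroup X.U) ∧ IsSlimGroup (𝓐.fundGroup Y.U) ∧
        Function.Injective (𝓐.fundMap f.hom) ∧
          AbsoluteAnabelian.IsRelativelySlim (𝓐.fundMap f.hom) ∧
          ∀ f' : X ⟶ Y,
            (∃ k : 𝓐.fundGroup Y.U, ∀ g, 𝓐.fundMap f'.hom g = k * 𝓐.fundMap f.hom g * k⁻¹) →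
              f' = f

/-- **Prop 4.4 (iv)**, first sentence: if `H → K`, `L → K` are finite étale (between finite
objects), "every morphism `H → L` in `Loc(𝔾, Γ)` lying over `K` is finite étale and induces a finite
étale morphism on associated anabelioids" [an open injection on `π̂₁`].
[cite: MochizukiSemiAnbd2006, Prop 4.4 (iv), p. 54] -/
def AssociatedAnabelioidsStatementIV (G : Obj) (Γ : Subgroup (Aut G)) : Prop :=
  LocHypotheses 𝓥 G Γ →
    ∀ (X Z Y : LocObj 𝓥 G Γ) (f : X ⟶ Y) (g : Z ⟶ Y) (h : X ⟶ Z),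
      X.IsFiniteObj 𝓥 → Y.IsFiniteObj 𝓥 → Z.IsFiniteObj 𝓥 →
        LocHom.IsFiniteEtale 𝓥 f → LocHom.IsFiniteEtale 𝓥 g → h ≫ g = f →
          LocHom.IsFiniteEtale 𝓥 h ∧ Function.Injective (𝓐.fundMap h.hom) ∧
            IsOpen (Set.range (𝓐.fundMap h.hom))

/-- **Prop 4.4 (iv)**, second sentence: "the full subcategory of such finite étale objects over `K`
determines a full embedding `B(K)⁰ ↪ Loc(𝔾, Γ)_K`" — a fully faithful functor from the connected
objects of `B(Π_K)` to `Loc(𝔾, Γ)_K = Over K` whose essential image consists of the finite étale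
objects over `K`. [cite: MochizukiSemiAnbd2006, Prop 4.4 (iv), p. 54] -/
def AnabelioidEmbeddingStatement (G : Obj) (Γ : Subgroup (Aut G)) : Prop :=
  LocHypotheses 𝓥 G Γ →
    ∀ Y : LocObj 𝓥 G Γ, Y.IsFiniteObj 𝓥 →
      ∃ F : ConnectedPart (BCat (𝓐.fundGroup Y.U)) ⥤ Over Y,
        F.Full ∧ F.Faithful ∧ ∀ Z : Over Y, F.essImage Z ↔ LocHom.IsFiniteEtale 𝓥 Z.hom

/-- **Prop 4.4 (iv)**, last sentence: "when `K = 𝔾`, we have `Loc(𝔾, Γ)_K = Loc(𝔾, Γ)`; the essential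
image of this embedding is the full subcategory of closed objects" — for a closed object `X₀` whose
`𝔾`-structure is an isomorphism (i.e. `X₀` "is" `𝔾`), the embedding `B(X₀)⁰ ↪ Over X₀` has essential
image the objects over `X₀` whose source is closed. [cite: MochizukiSemiAnbd2006, Prop 4.4 (iv), p. 55] -/
def AnabelioidEmbeddingBaseStatement (G : Obj) (Γ : Subgroup (Aut G)) : Prop :=
  LocHypotheses 𝓥 G Γ →
    ∀ X₀ : LocObj 𝓥 G Γ, (∃ p, X₀.str = some p ∧ IsIso p) →
      ∃ F : ConnectedPart (BCat (𝓐.fundGroup X₀.U)) ⥤ Over X₀,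
        F.Full ∧ F.Faithful ∧ ∀ Z : Over X₀, F.essImage Z ↔ Z.left.IsClosed 𝓥

/-! ### Remark 4.8.2, final clause -/

/-- **Rmk 4.8.2**, final clause: "if any of these conditions [(i)–(v)] is satisfied, then there is a
natural equivalence `Loc(𝔾, Γ)^⊥ ⥲ B(𝔾)` — so, in particular, `Loc(𝔾, Γ)^⊥` does not depend on the
action of `Γ`" — typed with condition (i) (no closed edges) as the hypothesis and `B(𝔾) = B(Π_𝔾)`.
[cite: MochizukiSemiAnbd2006, Rmk 4.8.2, p. 60] -/
def DegenerateLocIsAnabelioidStatement (G : Obj) (Γ : Subgroup (Aut G)) : Prop :=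
  LocHypotheses 𝓥 G Γ → (∀ e : 𝓥.Edge G, ¬ 𝓥.IsClosedEdge e) →
    Nonempty (FiniteCoproductCompletion.{0} (LocObj 𝓥 G Γ) ≌ BCat (𝓐.fundGroup G))

end Loc

end Literature.AnabelianGeometry.SemiGraphs
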